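import Literature.Geometry.Riemannian.RiemannianDistance
import Mathlib.MeasureTheory.Integral.Lebesgue.Basic
import Mathlib.MeasureTheory.Measure.Lebesgue.Basic
import HarnessLib

/-!
# Distances for two metrics which agree off a closed set: reaching the set is not longer

Topic `Geometry/Riemannian`. Let `g₀`, `g₁` be Riemannian metrics on `M` with `g₁ = g₀` off a
closed set `K` (Weinstein's modified metric agrees with the original one off the new disk;
Weinstein 1968, proof of the main theorem, step (3)). If a point `q ∈ K` is at `g₀`-distance `< r`
from `x`, then some point `y ∈ K` is at `g₁`-distance `< r` from `x`
(`exists_mem_edist_lt_of_val_eq_off`): follow a `g₀`-short `C¹` path from `x` to `q` up to the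
FIRST time it meets `K`; before that time the two length integrands agree. This turns the
`θ`-density of the tour for `g₀` into hypothesis `hthin` of Weinstein's criterion for `g₁`.

## References

* A. Weinstein, Ann. of Math. (2) 87 (1968), 29–41, proof of the main theorem. [cite: Weinstein1968]
* B. O'Neill, *Semi-Riemannian Geometry* (1983), Ch. 5, Def. 15. [cite: ONeill1983, Ch. 5, Def. 15]

Tags: [RiemannianDistance] [Weinstein1968]
-/

noncomputable section

open Bundle Set Function Filter Manifold MeasureTheory
open scoped Manifold ContDiff Topology ENNReal

namespace Literature.Geometry.Riemannian

open Literature.Geometry.Lorentzian (PseudoRiemannianMetric)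
open Literature.Geometry.Lorentzian.PseudoRiemannianMetric

variable {E : Type*} [NormedAddCommGroup E] [NormedSpace ℝ E] [FiniteDimensional ℝ E]
  {H : Type*} [TopologicalSpace H]
  {I : ModelWithCorners ℝ E H} {M : Type*} [TopologicalSpace M] [ChartedSpace H M]
  [IsManifold I ∞ M] {n : ℕ∞ω}
  (g₀ g₁ : PseudoRiemannianMetric I n E (TangentSpace I : M → Type _))

/-- **Reaching `K` is not longer for `g₁` than for `g₀`** when `g₁ = g₀` off the closed set `K`:
if `q ∈ K` and `d₀(x, q) < r` then `d₁(x, y) < r` for some `y ∈ K`.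
[cite: Weinstein1968, proof of the main theorem] -/
theorem exists_mem_edist_lt_of_val_eq_off (hg₀ : g₀.IsRiemannian) (hg₁ : g₁.IsRiemannian)
    {K : Set M} (hK : IsClosed K) (heq : ∀ y : M, y ∉ K → g₁.val y = g₀.val y)
    {x q : M} (hq : q ∈ K) {r : ℝ≥0∞} (hxq : g₀.edist hg₀ x q < r) :
    ∃ y ∈ K, g₁.edist hg₁ x y < r := by
  /- a `g₀`-short `C¹` path from `x` to `q` -/
  obtain ⟨γ, hγ0, hγ1, hγs, hγlen⟩ : ∃ γ : ℝ → M, γ 0 = x ∧ γ 1 = q ∧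
      ContMDiffOn 𝓘(ℝ, ℝ) I 1 γ (Icc 0 1) ∧ g₀.length hg₀ γ 0 1 < r := by
    letI := g₀.riemannianBundle hg₀
    have hxq' : riemannianEDist I x q < r := hxq
    obtain ⟨γ, h0, h1, hs, hl⟩ := exists_lt_of_riemannianEDist_lt hxq'
    exact ⟨γ, h0, h1, hs, hl⟩
  have hγc : ContinuousOn γ (Icc 0 1) := hγs.continuousOn
  /- the first time the path meets `K` -/
  set T : Set ℝ := {t ∈ Icc (0 : ℝ) 1 | γ t ∈ K} with hT
  have h1T : (1 : ℝ) ∈ T := ⟨⟨zero_le_one, le_rfl⟩, by rw [hγ1]; exact hq⟩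
  have hTne : T.Nonempty := ⟨1, h1T⟩
  have hTbdd : BddBelow T := ⟨0, fun t ht ↦ ht.1.1⟩
  have hTcl : IsClosed T := by
    have : T = Icc (0 : ℝ) 1 ∩ γ ⁻¹' K := by
      ext t; simp only [hT, mem_setOf_eq, mem_inter_iff, mem_preimage]
    rw [this]
    exact hγc.preimage_isClosed_of_isClosed isClosed_Icc hK
  set s : ℝ := sInf T with hs
  have hsT : s ∈ T := hTcl.csInf_mem hTne hTbdd
  have hs0 : 0 ≤ s := hsT.1.1
  have hs1 : s ≤ 1 := hsT.1.2
  have hbefore : ∀ t ∈ Ico 0 s, γ t ∉ K := by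
    intro t ht hK'
    have htT : t ∈ T := ⟨⟨ht.1, ht.2.le.trans hs1⟩, hK'⟩
    exact absurd (csInf_le hTbdd htT) (not_le.2 ht.2)
  refine ⟨γ s, hsT.2, ?_⟩
  /- `d₁(x, γ s) ≤ L₁(γ|[0,s]) = L₀(γ|[0,s]) ≤ L₀(γ|[0,1]) < r` -/
  have hγs' : ContMDiffOn 𝓘(ℝ, ℝ) I 1 γ (Icc 0 s) := hγs.mono (Icc_subset_Icc le_rfl hs1)
  have h1 : g₁.edist hg₁ x (γ s) ≤ g₁.length hg₁ γ 0 s := by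
    rw [← hγ0]; exact edist_le_length hg₁ hs0 hγs'
  -- the two length integrands agree on `[0, s)`
  set f₀ : ℝ → ℝ≥0∞ := fun t ↦ ENNReal.ofReal (Real.sqrt (g₀.val (γ t) (mfderiv 𝓘(ℝ, ℝ) I γ t 1)
    (mfderiv 𝓘(ℝ, ℝ) I γ t 1))) with hf₀
  set f₁ : ℝ → ℝ≥0∞ := fun t ↦ ENNReal.ofReal (Real.sqrt (g₁.val (γ t) (mfderiv 𝓘(ℝ, ℝ) I γ t 1)
    (mfderiv 𝓘(ℝ, ℝ) I γ t 1))) with hf₁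
  have hagree : ∀ t ∈ Ico 0 s, f₁ t = f₀ t := by
    intro t ht
    simp only [hf₀, hf₁, heq (γ t) (hbefore t ht)]
  have h2 : g₁.length hg₁ γ 0 s = g₀.length hg₀ γ 0 s := by
    rw [length_eq_lintegral, length_eq_lintegral]
    show ∫⁻ t in Icc 0 s, f₁ t = ∫⁻ t in Icc 0 s, f₀ t
    rw [setLIntegral_congr (Ico_ae_eq_Icc (a := (0 : ℝ)) (b := s)).symm,
      setLIntegral_congr (Ico_ae_eq_Icc (a := (0 : ℝ)) (b := s)).symm]
    exact setLIntegral_congr_fun measurableSet_Ico hagree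
  have h3 : g₀.length hg₀ γ 0 s ≤ g₀.length hg₀ γ 0 1 := by
    rw [length_eq_lintegral, length_eq_lintegral]
    exact lintegral_mono_set (Icc_subset_Icc le_rfl hs1)
  calc g₁.edist hg₁ x (γ s) ≤ g₁.length hg₁ γ 0 s := h1
    _ = g₀.length hg₀ γ 0 s := h2
    _ ≤ g₀.length hg₀ γ 0 1 := h3
    _ < r := hγlen

end Literature.Geometry.Riemannian

end
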